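import Literature.AlgebraicGeometry.AbelianSchemes.LevelBasisFiniteEtaleCoverSurjective
import Literature.AlgebraicGeometry.AbelianSchemes.PolarizationUnitHypothesis
import Literature.AlgebraicGeometry.AbelianSchemes.AbelianSchemeBaseChangeComp
import Literature.AlgebraicGeometry.AbelianSchemes.LevelStructureTransportIso
import Literature.AlgebraicGeometry.AbelianSchemes.AbelianSchemeOverHomNoetherianAnyBase
import Literature.AlgebraicGeometry.AbelianSchemes.PoincarePullbackSliceSpread
import Literature.AlgebraicGeometry.AbelianSchemes.LevelStructureTorsionPointsBasis
import Literature.AlgebraicGeometry.AbelianSchemes.TorsionSectionGramUnits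
import Literature.AlgebraicGeometry.AbelianSchemes.PolarizationClausesOfThickening
import Literature.AlgebraicGeometry.AbelianSchemes.SymplecticLiftAlongBaseChangePoint
import Literature.AlgebraicGeometry.Morphisms.FiniteEtaleSurjectiveLift
import Literature.AlgebraicGeometry.Morphisms.RefinedValuativeCriterionDense
import Literature.AlgebraicGeometry.Motives.AlgPointsNilpotentThickening
import Literature.GroupTheory.FiniteAbelian.SimilitudeTransport
import HarnessLib

/-!
# Symplectic-liftability of a level structure spreads from ONE geometric point over a connected base
# ([Lan2013PELCompactifications] §1.3.6 Lemma 1.3.6.6 / Cor. 1.3.6.7; [MumfordFogartyKirwan1994] Ch. 7 §2 Prop. 7.3)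

Cell `hodgecm-mathlib` (D-0151), F-DAG second wave (h9) «local constancy of the type of a polarisation», SYMPLECTIC HALF
(h9-S), W3c ASSEMBLY (B-p13 (g19) under B-p11 (g16)'s W3 lead; consumer F-6 (V′) / F-10 (b4) «the symplectic locus is
open and closed»).  PROOF lane, theorems only (no definition, no named fact, no instance, no `sorry`).

[Lan2013PELCompactifications, Lemma 1.3.6.6]: a level-`n` structure `α_n` is symplectic-liftable iff it is so at every
geometric point `s̄`; Cor. 1.3.6.7: the condition is open and closed on `S`.  The tree's carrier ★
`LevelStructure.IsSymplecticLiftable` is the pointwise criterion; this file proves the SPREADING step behind Cor. 1.3.6.7: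

  **`LevelStructure.isSymplecticLiftable_of_nonempty_symplecticLift`** — over a connected, reduced, locally Noetherian
  `S` on which every positive integer is invertible, if `φ(s₀)` admits a symplectic lift of type `δ` at ONE geometric
  point `s₀` (for some witness `Θ₀` of `λ̄` at `s₀`), then `φ` is symplectic-liftable of type `δ` for the polarisation.

ROAD.  By ★ `nonempty_symplecticLift_iff_forall_level` (König) it suffices, at the target geometric point `s₁` and
witness `Θ₁`, to produce for every `M = kN` ONE symplectic similitude `(ℤ/M)^{2g} ⥲ A_{s₁}[M]` lifting `φ(s₁)`.  Fix `M`: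
★ [MFK94] Prop. 7.3 (`exists_finite_etale_surjective_levelStructure`) gives a finite étale surjective `B → S` with a
level-`M` structure on `A ×_S B`; lift `s₀` to `B` (★ `exists_specOver_of_surjective`), pass to the connected component
`T` through the lift (★ `exists_clopen_connected_component_surjective_of_mem_of_isLocallyNoetherian`: finite étale and
SURJECTIVE over the connected `S`), lift `s₁` to `t₁ ∈ T`, and work with `f : T → S`, `sᵢ = tᵢ ≫ f` and the level-`M`
structure `χ` on `A ×_S T` (moved along `(A ×_S B) ×_B T ≅ A ×_S T`, ★ `baseChangeCompGrpIso`, ★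
`LevelStructure.exists_comp_of_iso`).  On the CONNECTED `T` the `M`-torsion sections `φ.σᵢ ×_S T` have CONSTANT
coordinates `aᵢ` in the basis `χ` (★ `LevelStructure.exists_eq_section_of_pow_eq_one`), and B-p11's W3-core ★
`exists_rootsOfUnity_transport_weilPairingLevel` (the Poincaré discrepancy units of the translation action of `A_T[M](T)`
are global `M`-th roots of unity on `T`, rigid on a connected base) gives a power-compatible bijection `χΩ : μ_M(Ω₀) →
μ_M(Ω₁)` matching the Gram data `ē^{Θ₀}_M(χ_a(t₀), χ_b(t₀))` and `ē^{Θ₁}_M(χ_a(t₁), χ_b(t₁))`; ★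
`exists_similitude_transport` then carries the level-`M` similitude at `s₀` (★ (S1 ⇒) from the given lift) to one at
`s₁` with the same marks `σᵢ(s₁) = χ_{aᵢ}(t₁)` and root `χΩ ζ₀`.  No ampleness of `Θ₀` is used.

Also: `LevelStructure.nonempty_baseChange_comp` (a level structure on `A ×_S B` gives one on `A ×_S T` for `T → B`),
`isUnit_natCast_appTop_of_forall_residueField` (plumbing), and the corollaries `…_of_isSymplecticLiftable_at`
(hypothesis `Nonempty (SymplecticLift …)`) and `isSymplecticLiftable_iff_nonempty_symplecticLift` (given any geometric
point `s₀` and witness `Θ₀`: liftable ⇔ a lift exists at `s₀` for `Θ₀` — provided `Θ₀` is ample, for «⇒»).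

HC_CM is proved only modulo the 7 printed citations until rung 0 closes; count-neutral capital for F-6 (V′).

## References
* [Lan2013PELCompactifications] K.-W. Lan, *Arithmetic compactifications of PEL-type Shimura varieties*, LMS Monographs
  36 (2013), §1.3.6 Lemma 1.3.6.5 (p. 81), Lemma 1.3.6.6 and Cor. 1.3.6.7 (pp. 81–82).
* [MumfordFogartyKirwan1994] D. Mumford, J. Fogarty, F. Kirwan, *Geometric Invariant Theory*, 3rd ed. (1994), Ch. 7 §2
  Definitions 7.1 and 7.2 (p. 129), Proposition 7.3 (pp. 133–134).
* [StacksProject] The Stacks project, Tag 04MF (units and residue fields).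
* Tree: ★ `SymplecticLiftOfFiniteLevels` (S1), ★ `LevelBasisFiniteEtaleCoverSurjective` (C4), ★
  `Morphisms.FiniteEtaleSurjectiveLift`, ★ `LevelStructureTorsionPointsBasis`, ★ `TorsionSectionTranslationAction` /
  `TorsionSectionGramUnits` (B-p11 (g16) W3-core), ★ `GroupTheory.FiniteAbelian.SimilitudeTransport`, ★
  `PolarizationUnitHypothesis`, ★ `AbelianSchemeBaseChangeComp`, ★ `LevelStructureTransportIso`.
-/

noncomputable section

universe u

open CategoryTheory CategoryTheory.Limits AlgebraicGeometry

namespace Literature.AlgebraicGeometry.AbelianSchemes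

namespace AbelianSchemeOver

open Literature.AlgebraicGeometry.Motives Literature.AlgebraicGeometry.Morphisms
open Literature.GroupTheory.FiniteAbelian
open scoped MonObj


/-! ### §1 Plumbing: level structures along `T → B → S`, the level on a connected cover -/

section Plumbing

variable {S : Scheme.{u}} (A : AbelianSchemeOver S)

/-- **A level structure on `A ×_S B` restricts to one on `A ×_S T` along `j : T → B`** — base change of `ψ` along `j`
lives on `(A ×_S B) ×_B T`, which is `A ×_S T` as a GROUP scheme over `T` (★ `baseChangeCompGrpIso`), and level
structures move along isomorphisms of group schemes (★ `LevelStructure.exists_comp_of_iso`).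
[cite: MumfordFogartyKirwan1994, Ch. 7 §2 Definitions 7.1 and 7.2 (p. 129)] -/
theorem LevelStructure.nonempty_baseChange_comp {B T : Scheme.{u}} (b : B ⟶ S) (j : T ⟶ B) {g M : ℕ}
    (ψ : LevelStructure g M (A.baseChange b)) : Nonempty (LevelStructure g M (A.baseChange (j ≫ b))) := by
  let E := A.baseChangeCompGrpIso b j
  -- the underlying isomorphism of `T`-schemes `(A ×_S B) ×_B T ≅ A ×_S T`, a homomorphism
  let e : ((A.baseChange b).baseChange j).X ≅ (A.baseChange (j ≫ b)).X :=
    { hom := E.inv.hom.hom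
      inv := E.hom.hom.hom
      hom_inv_id := by
        change (E.inv ≫ E.hom).hom.hom = _
        rw [E.inv_hom_id]
        rfl
      inv_hom_id := by
        change (E.hom ≫ E.inv).hom.hom = _
        rw [E.hom_inv_id]
        rfl }
  haveI : IsMonHom e.hom := by
    change IsMonHom E.inv.hom.hom
    infer_instance
  obtain ⟨χ, -⟩ := LevelStructure.exists_comp_of_iso e (ψ.baseChange j)
  exact ⟨χ⟩

/-- `M` invertible on `S` stays invertible on any `T → S` (units map to units). [cite: StacksProject, Tag 04MF] -/
theorem isUnit_natCast_appTop_of_forall_residueField {T : Scheme.{u}} (f : T ⟶ S) (M : ℕ)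
    (hM : ∀ s : S, (M : S.residueField s) ≠ 0) : IsUnit (M : Γ(T, ⊤)) := by
  have h := (isUnit_natCast_of_forall_residueField S M hM).map f.appTop.hom
  rwa [map_natCast] at h

end Plumbing

/-! ### §2 The theorem -/

variable {S : Scheme.{u}} {A : AbelianSchemeOver S} {g N : ℕ}

/-- **SYMPLECTIC-LIFTABILITY FROM ONE GEOMETRIC POINT.**  Over a connected, reduced, locally Noetherian base `S` on
which every positive integer is invertible, let `A/S` be an abelian scheme of relative dimension `g` with a polarisation
`λ` and a level-`N` structure `φ` (`N ≠ 0`).  If at ONE geometric point `s₀` the level structure `φ(s₀)` lifts to a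
symplectic similitude `ẑ^{2g} ⥲ T̂(A_{s₀})` of type `δ` (a ★ `SymplecticLift` for some witness `Θ₀` of `λ̄` at `s₀`),
then `φ` is symplectic-liftable of type `δ` EVERYWHERE ([Lan2013PELCompactifications] Lemma 1.3.6.6 / Cor. 1.3.6.7:
the locus is open and closed).  Proof: by ★ `nonempty_symplecticLift_iff_forall_level` it suffices to produce a
level-`M` similitude at the target point `s₁` for each `M = kN`; take a finite étale surjective `B → S` trivialising
`A[M]` (★ [MFK94] Prop. 7.3), the connected component `T` of a lift of `s₀`, a lift `t₁ ∈ T` of `s₁`; on the connected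
`T` the marks `φ.σᵢ` have constant coordinates in the level-`M` basis, and the Gram matrix of that basis for `ē^Θ_M`
is «the same» at `t₀` and `t₁` up to a bijection of `μ_M` respecting powers (B-p11's W3-core: the Poincaré
discrepancy units are global `M`-th roots of unity on `T`, rigid on a connected base); ★ `exists_similitude_transport`
then carries the level-`M` similitude from `A_{s₀}` to `A_{s₁}`.
[cite: Lan2013PELCompactifications, §1.3.6 Lemma 1.3.6.6 and Cor. 1.3.6.7 (pp. 81–82)]
[cite: MumfordFogartyKirwan1994, Ch. 7 §2 Proposition 7.3 (pp. 133–134)] -/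
theorem LevelStructure.isSymplecticLiftable_of_nonempty_symplecticLift [PreconnectedSpace S] [IsLocallyNoetherian S]
    [IsReduced S] (hg : A.IsOfRelDim g) (hQ : ∀ M : ℕ, M ≠ 0 → ∀ s : S, (M : S.residueField s) ≠ 0)
    (φ : A.LevelStructure g N) (hN : N ≠ 0) {D : A.DualPair} (pol : A.Polarization D) (δ : Fin g → ℕ)
    {Ω₀ : Type u} [Field Ω₀] [IsAlgClosed Ω₀] (s₀ : Spec (.of Ω₀) ⟶ S)
    (Θ₀ : CartierDivisor (A.fibre s₀).toAbelianVariety.X.left) (hΘ₀ : A.IsLambdaOfAt s₀ D pol.lam Θ₀)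
    (Λ₀ : φ.SymplecticLift s₀ Θ₀ δ) : φ.IsSymplecticLiftable pol δ := by
  classical
  intro Ω₁ _ _ s₁ Θ₁ _ hΘ₁
  refine (φ.nonempty_symplecticLift_iff_forall_level s₁ Θ₁ δ hN).2 fun k hk => ?_
  -- the level `M = kN`
  have hM0 : k * N ≠ 0 := Nat.mul_ne_zero hk hN
  haveI : NeZero (k * N) := ⟨hM0⟩
  have hQM : ∀ s : S, ((k * N : ℕ) : S.residueField s) ≠ 0 := hQ (k * N) hM0
  haveI : IsCommMonObj A.X := A.isCommMonObj_of_isLocallyNoetherian_base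
  haveI := pol.isMonHom
  -- a finite étale surjective cover `b : B → S` with a level-`M` structure `ψ`
  obtain ⟨B, b, hfin, het, hsurj, ⟨ψ⟩, -⟩ := A.exists_finite_etale_surjective_levelStructure (M := k * N) hg hQM
  haveI := hfin
  haveI := het
  haveI := hsurj
  -- lift `s₀` to `B`, take the connected component `T` through it (finite étale surjective over `S`)
  obtain ⟨t₀', ht₀'⟩ := exists_specOver_of_surjective b s₀
  obtain ⟨U, hU₀, -, hUconn, hUfin, hUet, hUsurj⟩ :=
    exists_clopen_connected_component_surjective_of_mem_of_isLocallyNoetherian b (t₀'.base (IsLocalRing.closedPoint Ω₀))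
  haveI := hUconn
  haveI := hUfin
  haveI := hUet
  haveI := hUsurj
  haveI : IsLocallyNoetherian B := LocallyOfFiniteType.isLocallyNoetherian b
  -- `t₀ : Spec Ω₀ → T` through `U`, `t₁ : Spec Ω₁ → T` over `s₁`
  have hrange : Set.range t₀'.base ⊆ Set.range (U.ι).base := by
    rintro _ ⟨c, rfl⟩
    rw [Subsingleton.elim c (IsLocalRing.closedPoint Ω₀), Scheme.Opens.range_ι]
    exact hU₀
  let t₀ : Spec (.of Ω₀) ⟶ (U : Scheme.{u}) := IsOpenImmersion.lift U.ι t₀' hrange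
  have ht₀ : t₀ ≫ (U.ι ≫ b) = s₀ := by
    rw [← Category.assoc, IsOpenImmersion.lift_fac, ht₀']
  obtain ⟨t₁, ht₁⟩ := exists_specOver_of_surjective (U.ι ≫ b) s₁
  -- the level-`M` structure `χ` on `A ×_S T`, `T := U`
  obtain ⟨χ⟩ := LevelStructure.nonempty_baseChange_comp A b U.ι ψ
  -- work over `T` with `f := U.ι ≫ b`; the two geometric points of `S` ARE `tᵢ ≫ f`
  generalize hf : U.ι ≫ b = f at ht₀ ht₁ χ
  subst ht₀ ht₁
  haveI : IsCommMonObj (A.baseChange f).X := (A.baseChange f).isCommMonObj_of_isLocallyNoetherian_base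
  -- `M` is invertible on `T` and in `Ω₀`, `Ω₁`
  have hMT : IsUnit ((k * N : ℕ) : Γ((U : Scheme.{u}), ⊤)) := isUnit_natCast_appTop_of_forall_residueField f _ hQM
  have hMTres : ∀ u : (U : Scheme.{u}), ((k * N : ℕ) : (U : Scheme.{u}).residueField u) ≠ 0 :=
    natCast_residueField_ne_zero_of_hom f hQM
  have hM₀ : ((k * N : ℕ) : Ω₀) ≠ 0 := natCast_ne_zero_of_residueField (t₀ ≫ f) _ hQM
  have hM₁ : ((k * N : ℕ) : Ω₁) ≠ 0 := natCast_ne_zero_of_residueField (t₁ ≫ f) _ hQM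
  -- the level-`M` structure `χ` on `A ×_S T`
  -- W3-core (B-p11 FILE 2): the Gram data of the `M`-torsion sections of `A ×_S T` at `t₀` and at `t₁` correspond
  obtain ⟨χΩ, hprim, hpow, hGram⟩ := A.exists_rootsOfUnity_transport_weilPairingLevel D
    pol.nonempty_unitHatSlice_iso pol.lam f hMT t₀ t₁ hM₀ hM₁ Θ₀ Θ₁ hΘ₀ hΘ₁
  haveI inst₀ := AbelianVariety.isDominant_toSchemeHom_zsmul_of_ne_zero (A.fibre (t₀ ≫ f)).toAbelianVariety hM₀
  haveI inst₁ := AbelianVariety.isDominant_toSchemeHom_zsmul_of_ne_zero (A.fibre (t₁ ≫ f)).toAbelianVariety hM₁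
  -- the basis homomorphism `sec : (ℤ/M)^{2g} →* A_T[M](T)` of `χ`
  obtain ⟨Sg, hSg⟩ := χ.exists_monoidHom_section
  have hSgM : ∀ c, Sg c ∈ (A.baseChange f).torsionSections (k * N) := fun c => by
    rw [mem_torsionSections_iff, ← ofAdd_toAdd c, hSg]
    exact (A.baseChange f).sectionPow_pow_eq_one χ.pow_σ _
  let sec : Multiplicative (Fin g ⊕ Fin g → ZMod (k * N)) →* (A.baseChange f).torsionSections (k * N) :=
    Sg.codRestrict _ hSgM
  have hsec : ∀ a : Fin g ⊕ Fin g → ZMod (k * N),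
      ((sec (Multiplicative.ofAdd a) : (A.baseChange f).torsionSections (k * N)) : (A.baseChange f).Sections) =
        χ.section_ a := fun a => hSg a
  -- the bases `Ψ_t := (χ(t) read on A_{t ≫ f})` are BIJECTIVE onto the `M`-torsion at every geometric point `t` of `T`
  have hΨbij : ∀ (Ω' : Type u) [Field Ω'] [IsAlgClosed Ω'] (t : Spec (.of Ω') ⟶ (U : Scheme.{u})),
      Function.Bijective ((A.baseChangeTorsionPt (k * N) f t).comp sec) := by
    intro Ω' _ _ t
    constructor
    · intro c d hcd
      have h1 := congrArg (fun P : (A.fibre (t ≫ f)).toAbelianVariety.torsionPoints Ω' ((k * N : ℕ) : ℤ) =>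
        (P : (A.fibre (t ≫ f)).toAbelianVariety.Points Ω')) hcd
      simp only [MonoidHom.comp_apply, coe_baseChangeTorsionPt] at h1
      have h2 := (A.fibrePointsMulEquiv f t).injective h1
      rw [← ofAdd_toAdd c, ← ofAdd_toAdd d, hsec, hsec] at h2
      rw [← ofAdd_toAdd c, ← ofAdd_toAdd d, χ.restrictPt_section_injective t h2]
    · intro Q
      have hQ : (Q : (A.fibre (t ≫ f)).toAbelianVariety.Points Ω') ^ (k * N) = 1 := by
        rw [← zpow_natCast]
        exact (AbelianVariety.mem_torsionPoints_iff _ _).1 Q.2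
      have hP' : (A.fibrePointsMulEquiv f t).symm (Q : (A.fibre (t ≫ f)).toAbelianVariety.Points Ω') ^ (k * N) = 1 := by
        rw [← map_pow, hQ, map_one]
      obtain ⟨a, ha⟩ := χ.exists_restrictPt_section_eq t _ hP'
      refine ⟨Multiplicative.ofAdd a, Subtype.ext ?_⟩
      rw [MonoidHom.comp_apply, coe_baseChangeTorsionPt, hsec, ha, MulEquiv.apply_symm_apply]
  -- MARKS: on the connected `T` the sections `φ.σᵢ ×_S T` have CONSTANT coordinates `a i` in the basis `χ`
  have hτ : ∀ i, A.sectionBaseChange f (φ.σ i) ^ (k * N) = 1 := fun i => by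
    rw [← map_pow, mul_comm, pow_mul, φ.pow_σ, one_pow, map_one]
  have hcoord : ∀ i, ∃ a : Fin g ⊕ Fin g → ZMod (k * N), A.sectionBaseChange f (φ.σ i) = χ.section_ a := fun i =>
    χ.exists_eq_section_of_pow_eq_one hMTres (hτ i) (t₀.base (IsLocalRing.closedPoint Ω₀))
  choose a ha using hcoord
  have hmark : ∀ (Ω' : Type u) [Field Ω'] [IsAlgClosed Ω'] (t : Spec (.of Ω') ⟶ (U : Scheme.{u})) (i : Fin g ⊕ Fin g),
      (((A.baseChangeTorsionPt (k * N) f t).comp sec (Multiplicative.ofAdd (a i)) :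
          (A.fibre (t ≫ f)).toAbelianVariety.torsionPoints Ω' ((k * N : ℕ) : ℤ)) :
        (A.fibre (t ≫ f)).toAbelianVariety.Points Ω') = A.restrictPt (t ≫ f) (φ.σ i) := by
    intro Ω' _ _ t i
    rw [MonoidHom.comp_apply, coe_baseChangeTorsionPt, hsec, ← ha i, fibrePointsMulEquiv_apply,
      map_fibreBaseChangeIso_restrictPt_sectionBaseChange]
  have hmem : ∀ (Ω' : Type u) [Field Ω'] (t : Spec (.of Ω') ⟶ (U : Scheme.{u})) (i : Fin g ⊕ Fin g),
      A.restrictPt (t ≫ f) (φ.σ i) ∈ (A.fibre (t ≫ f)).toAbelianVariety.torsionPoints Ω' ((k * N : ℕ) : ℤ) := by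
    intro Ω' _ t i
    refine (AbelianVariety.mem_torsionPoints_iff _ _).2 ?_
    rw [zpow_natCast]
    exact A.restrictPt_pow_eq_one _ (by rw [mul_comm, pow_mul, φ.pow_σ, one_pow])
  -- the level-`M` datum at `t₀` (forget the tower `Λ₀` to the level `kN`)
  obtain ⟨ζ₀, L₀, hζ₀, hL₀, hL₀mark, hL₀pair⟩ :=
    (φ.nonempty_symplecticLift_iff_forall_level (t₀ ≫ f) Θ₀ δ hN).1 ⟨Λ₀⟩ k hk
  -- TRANSPORT of the similitude along the Gram correspondence `χΩ` and the common coordinates of the marks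
  obtain ⟨-, L₁, -, hL₁, hL₁mark, hL₁pair⟩ := exists_similitude_transport
    (fun P Q => (A.fibre (t₀ ≫ f)).toAbelianVariety.weilPairingLevel Θ₀ P Q)
    (fun P Q => (A.fibre (t₁ ≫ f)).toAbelianVariety.weilPairingLevel Θ₁ P Q)
    (fun x y z => AbelianVariety.weilPairingLevel_mul_left Θ₀ x y z)
    (fun x y z => AbelianVariety.weilPairingLevel_mul_right Θ₀ x y z)
    (fun x y => AbelianVariety.weilPairingLevel_pow_card_eq_one Θ₀ x y)
    (fun x y z => AbelianVariety.weilPairingLevel_mul_left Θ₁ x y z)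
    (fun x y z => AbelianVariety.weilPairingLevel_mul_right Θ₁ x y z)
    (fun x y => AbelianVariety.weilPairingLevel_pow_card_eq_one Θ₁ x y)
    ((A.baseChangeTorsionPt (k * N) f t₀).comp sec) (hΨbij Ω₀ t₀)
    ((A.baseChangeTorsionPt (k * N) f t₁).comp sec) (hΨbij Ω₁ t₁)
    χΩ hprim hpow
    (fun a' b' => hGram (sec (Multiplicative.ofAdd (Pi.single a' 1))) (sec (Multiplicative.ofAdd (Pi.single b' 1))))
    (typeFormMod δ (k * N)) k
    (fun i => ⟨A.restrictPt (t₀ ≫ f) (φ.σ i), hmem Ω₀ t₀ i⟩)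
    (fun i => ⟨A.restrictPt (t₁ ≫ f) (φ.σ i), hmem Ω₁ t₁ i⟩)
    (fun i => ⟨Multiplicative.ofAdd (a i), Subtype.ext (hmark Ω₀ t₀ i), Subtype.ext (hmark Ω₁ t₁ i)⟩)
    hζ₀ L₀ hL₀
    (fun i => Subtype.ext (by rw [SubmonoidClass.coe_pow]; exact hL₀mark i))
    (fun x y => hL₀pair hM₀ x y)
  refine ⟨χΩ ζ₀, L₁, hprim ζ₀ hζ₀, hL₁, fun i => ?_, fun hMΩ x y => ?_⟩
  · have h := congrArg Subtype.val (hL₁mark i)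
    rw [SubmonoidClass.coe_pow] at h
    exact h
  · have h := hL₁pair x y
    convert h using 2

/-- **Hypothesis in `Nonempty` form**: symplectic-liftability of type `δ` spreads from the existence of a symplectic lift
at ONE geometric point (connected, reduced, locally Noetherian base with all `M ≠ 0` invertible).
[cite: Lan2013PELCompactifications, §1.3.6 Lemma 1.3.6.6 and Cor. 1.3.6.7 (pp. 81–82)] -/
theorem LevelStructure.isSymplecticLiftable_of_isSymplecticLiftable_at [PreconnectedSpace S] [IsLocallyNoetherian S]
    [IsReduced S] (hg : A.IsOfRelDim g) (hQ : ∀ M : ℕ, M ≠ 0 → ∀ s : S, (M : S.residueField s) ≠ 0)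
    (φ : A.LevelStructure g N) (hN : N ≠ 0) {D : A.DualPair} (pol : A.Polarization D) (δ : Fin g → ℕ)
    {Ω₀ : Type u} [Field Ω₀] [IsAlgClosed Ω₀] (s₀ : Spec (.of Ω₀) ⟶ S)
    (Θ₀ : CartierDivisor (A.fibre s₀).toAbelianVariety.X.left) (hΘ₀ : A.IsLambdaOfAt s₀ D pol.lam Θ₀)
    (h : Nonempty (φ.SymplecticLift s₀ Θ₀ δ)) : φ.IsSymplecticLiftable pol δ :=
  h.elim fun Λ₀ => φ.isSymplecticLiftable_of_nonempty_symplecticLift hg hQ hN pol δ s₀ Θ₀ hΘ₀ Λ₀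

/-- **Liftability is decided at any single geometric point** (connected, reduced, locally Noetherian base with all
`M ≠ 0` invertible): for an AMPLE witness `Θ₀` of `λ̄` at `s₀`, `φ` is symplectic-liftable of type `δ` iff `φ(s₀)` has a
symplectic lift for `Θ₀` ([Lan2013PELCompactifications] Lemma 1.3.6.6 with Cor. 1.3.6.7 on a connected base).
[cite: Lan2013PELCompactifications, §1.3.6 Lemma 1.3.6.6 and Cor. 1.3.6.7 (pp. 81–82)] -/
theorem LevelStructure.isSymplecticLiftable_iff_nonempty_symplecticLift [PreconnectedSpace S] [IsLocallyNoetherian S]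
    [IsReduced S] (hg : A.IsOfRelDim g) (hQ : ∀ M : ℕ, M ≠ 0 → ∀ s : S, (M : S.residueField s) ≠ 0)
    (φ : A.LevelStructure g N) (hN : N ≠ 0) {D : A.DualPair} (pol : A.Polarization D) (δ : Fin g → ℕ)
    {Ω₀ : Type u} [Field Ω₀] [IsAlgClosed Ω₀] (s₀ : Spec (.of Ω₀) ⟶ S)
    (Θ₀ : CartierDivisor (A.fibre s₀).toAbelianVariety.X.left) (hΘ₀amp : Θ₀.IsAmple)
    (hΘ₀ : A.IsLambdaOfAt s₀ D pol.lam Θ₀) :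
    φ.IsSymplecticLiftable pol δ ↔ Nonempty (φ.SymplecticLift s₀ Θ₀ δ) :=
  ⟨fun h => h.nonempty s₀ hΘ₀amp hΘ₀,
    fun h => φ.isSymplecticLiftable_of_isSymplecticLiftable_at hg hQ hN pol δ s₀ Θ₀ hΘ₀ h⟩

/-! ### §3 Dropping `[IsReduced S]`: pass to `S_red` (the clauses only see geometric points) -/

/-- `X_red` of a preconnected scheme is preconnected (`X_red → X` is a homeomorphism). [cite: StacksProject, Tag 01IZ] -/
theorem preconnectedSpace_nilradical_subscheme (X : Scheme.{u}) [PreconnectedSpace X] :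
    PreconnectedSpace X.nilradical.subscheme := by
  have hh : IsHomeomorph X.nilradical.subschemeι.base :=
    (isHomeomorph_iff_isEmbedding_surjective).2
      ⟨X.nilradical.subschemeι.isClosedEmbedding.isEmbedding, X.nilradical.subschemeι.surjective⟩
  let e := hh.homeomorph
  refine ⟨?_⟩
  have h := isPreconnected_univ.image e.symm e.symm.continuous.continuousOn
  rwa [Set.image_univ, EquivLike.range_eq_univ] at h

/-- **SYMPLECTIC-LIFTABILITY FROM ONE GEOMETRIC POINT, ANY connected locally Noetherian base on which every `M ≠ 0` is
invertible** (no reducedness): both the hypothesis (a symplectic lift at `s₀`) and the conclusion (★ `IsSymplecticLiftable`,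
[Lan2013PELCompactifications] Lemma 1.3.6.6's pointwise criterion) only see GEOMETRIC points, which factor through
`S_red ↪ S` (★ `Motives.exists_comp_eq_of_isClosedImmersion_of_surjective`); over the reduced, connected, locally
Noetherian `S_red` the spreading is `isSymplecticLiftable_of_nonempty_symplecticLift` for `(A, φ, λ) ×_S S_red` (the lift
moves to the base change by ★ `nonempty_symplecticLift_baseChange_iff`, the witness clause by ★ `IsLambdaOfAt.baseChange`),
and liftability descends back along the surjective closed immersion `S_red ↪ S` by ★
`isSymplecticLiftable_baseChange_iff_of_surjective`. [cite: Lan2013PELCompactifications, §1.3.6 Lemma 1.3.6.6 and Cor. 1.3.6.7 (pp. 81–82)]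
[cite: MumfordFogartyKirwan1994, Ch. 7 §2 Proposition 7.3 (pp. 133–134)] -/
theorem LevelStructure.isSymplecticLiftable_of_nonempty_symplecticLift_of_isLocallyNoetherian [PreconnectedSpace S]
    [IsLocallyNoetherian S] (hg : A.IsOfRelDim g) (hQ : ∀ M : ℕ, M ≠ 0 → ∀ s : S, (M : S.residueField s) ≠ 0)
    (φ : A.LevelStructure g N) (hN : N ≠ 0) {D : A.DualPair} (pol : A.Polarization D) (δ : Fin g → ℕ)
    {Ω₀ : Type u} [Field Ω₀] [IsAlgClosed Ω₀] (s₀ : Spec (.of Ω₀) ⟶ S)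
    (Θ₀ : CartierDivisor (A.fibre s₀).toAbelianVariety.X.left) (hΘ₀ : A.IsLambdaOfAt s₀ D pol.lam Θ₀)
    (Λ₀ : φ.SymplecticLift s₀ Θ₀ δ) : φ.IsSymplecticLiftable pol δ := by
  let i := S.nilradical.subschemeι
  haveI : IsLocallyNoetherian S.nilradical.subscheme := LocallyOfFiniteType.isLocallyNoetherian i
  haveI : PreconnectedSpace S.nilradical.subscheme := preconnectedSpace_nilradical_subscheme S
  -- the geometric point factors through `S_red`
  obtain ⟨s₀', rfl⟩ := Motives.exists_comp_eq_of_isClosedImmersion_of_surjective i s₀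
  -- move the lift and the witness clause to `A ×_S S_red` at `s₀'`
  obtain ⟨Λ₀'⟩ := (φ.nonempty_symplecticLift_baseChange_iff i s₀' Θ₀ δ).1 ⟨Λ₀⟩
  haveI := pol.isMonHom
  have hΘ₀' : (A.baseChange i).IsLambdaOfAt s₀' (D.baseChange i) (pol.baseChange i).lam (A.divisorBaseChange i s₀' Θ₀) :=
    hΘ₀.baseChange
  have h := (φ.baseChange i).isSymplecticLiftable_of_nonempty_symplecticLift (hg.baseChange i)
    (fun M hM => natCast_residueField_ne_zero_of_hom i (hQ M hM)) hN (pol.baseChange i) δ s₀' _ hΘ₀' Λ₀'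
  exact (LevelStructure.isSymplecticLiftable_baseChange_iff_of_surjective A i pol φ δ).1 h

end AbelianSchemeOver

end Literature.AlgebraicGeometry.AbelianSchemes

end
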